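import Summits.BirchSwinnertonDyer.BirchSwinnertonDyer.Theorems.ByReductionTypeAtTwoMultTransportTwistedDescentLocalT2
import Summits.BirchSwinnertonDyer.BirchSwinnertonDyer.Theorems.ByReductionTypeAtTwoMultTransportTwistedDescentT2Core
import Literature.NumberTheory.EllipticCurves.HeegnerPointsKolyvaginCebotarevProofs
import HarnessLib

/-!
# T-42-mult in the kernel, XLI: the local statement `T2` at the prime `2` is a THEOREM; hence
# `hF3b` follows from Greenberg's Prop. 4.9 alone (`hF3b_of_prop49_alone`)

Cell `bsd-2adic` (run/shared/lean/pub/bsd-2adic/), seat `bsd-2adic-t42` (BRIEF-T42), GEN 17. HONEST FRAMING: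
research route; THEOREMS ONLY (no `def`, no named fact, no instance); nothing booked; nothing re-keyed
(RC-169); BSD is not proved by any of this. PARTITION: X5@2 multiplicative GV-transport rows (K4ᵐ B1·O1
`MultCongruenceTransportAtTwo`; the binder `hF3b` of `multCongruenceTransportAtTwo_of_corePrint_all`, p525936)
× p = 2 — closes-the-local-input-of; bears_on K4 items 19922 / 19923 (`--supports stmt-BirchSwinnertonDyer-19923`).

## What

* `localTwistedClass_T2` — **the hypothesis `T2` of `hF3b_of_prop49_T2` (file XXX), verbatim, is a theorem**:
  for the globally minimal `E/ℚ` with multiplicative reduction at `2`, the cyclotomic `ℤ_2`-extension `κ` with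
  topological generator `γ`, the set of odd `u` for which the local twisted descent at the places `v ∋ 2` fails
  is finite — indeed contained in `{1}`: for `u ≠ 1` file XL (`exists_twisted_class_of_kummer`, Greenberg LNM 1716
  §4 p. 124 at `p = 2`) produces the class `t`, and the place `v ∋ 2` of `ℚ` is unique.
* `hF3b_of_prop49_alone` — hence the conclusion of `hF3b` (no non-zero finite `Λ`-submodule in the non-primitive
  dual Selmer data at `2`) follows from Greenberg's Prop. 4.9 (`prop49_noFiniteSubmodule_H1Sigma`, the one
  remaining named input) — `hF3b_of_prop49_T2` with `T2 := localTwistedClass_T2`.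

References: [GreenbergLNM1716] §4 Prop. 4.9, pp. 105–108, 123–125; [GreenbergVatsal2000] §2 pp. 14–17.
-/

set_option autoImplicit false
set_option linter.dupNamespace false

noncomputable section

open scoped Classical ContRepresentation

universe u

namespace Summit.BirchSwinnertonDyer.BirchSwinnertonDyer.Theorems.MultTransportTwistedDescent

open NumberField IsDedekindDomain Field WeierstrassCurve CategoryTheory
  Literature.NumberTheory.EllipticCurves Literature.NumberTheory.EllipticCurves.GreenbergVatsal2000
  Literature.NumberTheory.EllipticCurves.Greenberg1999
  Literature.NumberTheory.GaloisRepresentations Literature.NumberTheory.GaloisCohomology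
  Summit.BirchSwinnertonDyer.BirchSwinnertonDyer.Theorems.MultTransportAtTwo
  Summit.BirchSwinnertonDyer.BirchSwinnertonDyer.Theorems.SchneiderFreeAdditiveX3
open Literature.NumberTheory.GaloisRepresentations.DiscreteGaloisModule (localTatePairingZMod
  unramifiedSubgroup SelmerStructure TateDual)

/-- **`T2` holds**: the exceptional set of odd `u` is contained in `{1}` (file XL at every `v ∋ 2`, and the place
of `ℚ` above `2` is unique). [cite: GreenbergLNM1716, §4 pp. 107, 124] [cite: GreenbergVatsal2000, §2 pp. 14–17] -/
theorem localTwistedClass_T2 :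
    ∀ (W : WeierstrassCurve ℚ) [W.IsElliptic] [W.IsGloballyMinimal],
    W.HasMultiplicativeReductionAtPrime 2 →
    ∀ (κ : ZpExtension ℚ 2) (_hκ : κ.IsCyclotomic) (γ : absoluteGaloisGroup ℚ)
      (_hγ : κ.IsTopGenerator γ),
    {u : ℤ | (2 : ℤ) ∣ u - 1 ∧
      ¬ ∀ c : W.subgroupH1 2 κ.kerSubgroup,
      (∀ v ∈ {v : HeightOneSpectrum (𝓞 ℚ) | ((2 : ℕ) : 𝓞 ℚ) ∈ v.asIdeal},
          u • W.conjH1 2 κ.kerSubgroup γ c - c ∈ W.localKerOver 2 κ.kerSubgroup (v.adicCompletion ℚ)) →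
      ∃ (hu : (2 : ℤ) ∣ u - 1) (J : ℕ),
        ∀ v ∈ {v : HeightOneSpectrum (𝓞 ℚ) | ((2 : ℕ) : 𝓞 ℚ) ∈ v.asIdeal},
          ∃ t : galoisCohomology
            ((W.twistedTorsionGaloisModule 2 κ J u hu).restrictField (v.adicCompletion ℚ)) 1,
            W.twistedTorsionToLocalH1 2 κ J u hu (v.adicCompletion ℚ) t =
              W.localResOver 2 κ.kerSubgroup (v.adicCompletion ℚ) c}.Finite := by
  intro W _ _ hmult κ hκ γ hγ
  refine (Set.finite_singleton (1 : ℤ)).subset ?_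
  rintro u ⟨hu, hnot⟩
  rw [Set.mem_singleton_iff]
  by_contra hu1
  apply hnot
  intro c hcK
  refine ⟨hu, ?_⟩
  by_cases hex : ∃ v₀ : HeightOneSpectrum (𝓞 ℚ), ((2 : ℕ) : 𝓞 ℚ) ∈ v₀.asIdeal
  · obtain ⟨v₀, hv₀⟩ := hex
    obtain ⟨J, t, ht⟩ := exists_twisted_class_of_kummer W hmult κ hκ γ hγ hv₀ u hu hu1 c (hcK v₀ hv₀)
    refine ⟨J, fun v hv ↦ ?_⟩
    obtain rfl : v₀ = v :=
      Literature.NumberTheory.EllipticCurves.HeightOneSpectrum.eq_of_natCast_mem_rat Nat.prime_two hv₀ hv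
    exact ⟨t, ht⟩
  · exact ⟨0, fun v hv ↦ (hex ⟨v, hv⟩).elim⟩

/-- **`hF3b` from Greenberg's Prop. 4.9 alone**: the conclusion of the binder `hF3b` of
`multCongruenceTransportAtTwo_of_corePrint_all` (no non-zero finite `Λ`-submodule of the non-primitive dual Selmer
data at `2` for minimal `E/ℚ` with multiplicative reduction at `2`), granted `prop49_noFiniteSubmodule_H1Sigma`
(Greenberg LNM 1716 Prop. 4.9); everything else — Poitou–Tate, `δ2` (file XXIX), `T2` (this file) — is a theorem.
[cite: GreenbergLNM1716, §4 Prop. 4.9, pp. 105–108, 123–125] [cite: GreenbergVatsal2000, §2 pp. 14–17] -/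
theorem hF3b_of_prop49_alone (h49 : prop49_noFiniteSubmodule_H1Sigma) :
    ∀ (W : WeierstrassCurve ℚ) [W.IsElliptic] [W.IsGloballyMinimal],
      W.HasMultiplicativeReductionAtPrime 2 →
      ∀ (κ : ZpExtension ℚ 2) (_hκ : κ.IsCyclotomic) (γ : absoluteGaloisGroup ℚ)
        (_hγ : κ.IsTopGenerator γ) (S₀ : Finset (HeightOneSpectrum (𝓞 ℚ)))
        (_hne : S₀.Nonempty)
        (_hS₀ : ∀ v ∈ S₀, ((2 : ℕ) : 𝓞 ℚ) ∉ v.asIdeal)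
        (_hbad : ∀ v : HeightOneSpectrum (𝓞 ℚ), v ∉ S₀ → ((2 : ℕ) : 𝓞 ℚ) ∉ v.asIdeal →
          W.HasGoodReductionAt v)
        (D : W.SelmerDualData κ γ) [Module.Finite (IwasawaAlgebra 2) D.X], D.IsTorsion →
        ∀ (DS : NonPrimitiveDualData W κ γ (↑S₀ : Set (HeightOneSpectrum (𝓞 ℚ))))
          (N : Submodule (IwasawaAlgebra 2) DS.X), Finite N → N = ⊥ :=
  hF3b_of_prop49_T2 h49 localTwistedClass_T2

end Summit.BirchSwinnertonDyer.BirchSwinnertonDyer.Theorems.MultTransportTwistedDescent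

end
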